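import Literature.NumberTheory.QuadraticFields.BakerTwoLogValues
import Literature.NumberTheory.Transcendental.TwoLogarithmsExplicit
import HarnessLib

/-!
# Baker's class number one argument: the large range `p₀ > 10⁸⁰`

Topic `NumberTheory/QuadraticFields`, namespace `Literature.NumberTheory.QuadraticFields.BakerLimitFormula`.
Everything here is PROVED.

Baker 1975, Ch. 5 §4 (p. 51): "`|b log ε + b' log ε'| < e^{-δB}` … But by Theorem 3.1 we have
`|Λ| > B^{-C}` for some computable `C = C(ε, ε')`, and so `d` is bounded" — and Baker–Wüstholz 2007,
§3.1: "It follows that `d` is bounded … In practice we obtain an explicit bound for `d`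
(originally `10⁵⁰⁰`, now about `10²⁰`)". Here, with the tree's crude but fully explicit and fully
proved two-logarithm bound `TwoLog.lower_bound_explicit` (interpolation determinants + Philippon's
zero estimate + Liouville) applied in the field `ℚ(ε₂₁, ε₃₃)` (`BakerTwoLogData.lean`: `D = 4`,
`A = 47`, `W = 88`), Liouville's bound for small coefficients (`abs_linearForm_ge_of_le`) and the
identification `X_k = 2h(k) log ε_k` (`BakerTwoLogValues.lean`), we prove the `large` hypothesis of
`heegnerStarkPrimeThreeModEight_of_ranges` with `P₀ = 10⁸⁰`:

* `baker_large_range` — for `p₀ > 10⁸⁰` and all `h₂₁ ∈ [1, 2(21p₀)²]`, `h₃₃ ∈ [1, 2(33p₀)²]`,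
  `35280 e^{-π√p₀/21} + 34848 e^{-π√p₀/33} < |105 h₂₁ X₂₁ - 66 h₃₃ X₃₃|`;
* `heegnerStarkPrimeThreeModEight_of_small` — hence `HeegnerStarkPrimeThreeModEight` follows from
  the enumeration of the range `p₀ ≤ 10⁸⁰` alone (Stark's/Baker's continued-fraction reduction of
  the medium range and a finite check are what remains).

## References

* A. Baker, *Transcendental Number Theory* (1975), Ch. 5 §§4–5 (pp. 51–52). [Baker1975]
* A. Baker, G. Wüstholz, *Logarithmic Forms and Diophantine Geometry* (2007), §3.1 p. 37.
  [BakerWustholz2007]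
-/

noncomputable section

open Real Complex Module NumberField
open Literature.NumberTheory.QuadraticFields.Quadratic Literature.NumberTheory.QuadraticFields.BakerTwoLog
open Literature.NumberTheory.Transcendental Literature.NumberTheory.Transcendental.TwoLog
open scoped NumberTheorySymbols

namespace Literature.NumberTheory.QuadraticFields.BakerLimitFormula

/-! ### The lower bound for the linear form `u log ε₂₁ - v log ε₃₃` -/

/-- The constant `C = 10⁹ · 4⁴ · 88⁴` of the explicit two-logarithm bound in `ℚ(ε₂₁, ε₃₃)`.
[folklore] -/
def bakerC : ℝ := 10 ^ 9 * (4 : ℝ) ^ 4 * (88 : ℝ) ^ 4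

/-- `W = 88` is admissible: `2e(log ε₂₁ + (log ε₃₃ + 1)) + 4 + 12 log 47 ≤ 88`. [folklore] -/
theorem W_admissible :
    2 * Real.exp 1 * (‖(Real.log e21 : ℂ)‖ + (Real.log e33 + 1)) + 4 + 4 * ((4 : ℕ) - 1 : ℝ) * Real.log 47 ≤
      (88 : ℕ) := by
  have he := exp_one_bounds
  have h1 := log_e21_lt
  have h2 := log_e33_lt
  have h3 : Real.log 47 ≤ 4 := by
    rw [Real.log_le_iff_le_exp (by norm_num)]
    have : Real.exp 4 = Real.exp 1 ^ 4 := by rw [← Real.exp_nat_mul]; norm_num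
    rw [this]; nlinarith [pow_le_pow_left₀ (by norm_num : (0:ℝ) ≤ 2.7) he.1.le 4]
  have hn : ‖(Real.log e21 : ℂ)‖ = Real.log e21 := by
    rw [Complex.norm_real, Real.norm_eq_abs, abs_of_pos (by linarith [three_half_lt_log_e21])]
  rw [hn]
  push_cast
  have h0 : 0 ≤ Real.log e21 := by linarith [three_half_lt_log_e21]
  nlinarith

/-- **Lower bound for the linear form**: for integers `1 ≤ u, v ≤ e^j` with `j ≥ 15`,
`|u log ε₂₁ - v log ε₃₃| ≥ exp(-C j⁴)`, `C = 10⁹·4⁴·88⁴`. (Trivial when `u log ε₂₁ ≥ (log ε₃₃ + 1)v`;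
Liouville when the reduced coefficients are `< 90112j`; the two-logarithm bound otherwise.)
[cite: Baker1975, Ch. 5 §4 (p. 51, "by Theorem 3.1 we have |Λ| > B^{-C}")] -/
theorem abs_linearForm_ge {u v j : ℕ} (hu : 1 ≤ u) (hv : 1 ≤ v) (hj : 15 ≤ j)
    (huj : (u : ℝ) ≤ Real.exp j) (hvj : (v : ℝ) ≤ Real.exp j) :
    Real.exp (-(bakerC * (j : ℝ) ^ 4)) ≤ |u * Real.log e21 - v * Real.log e33| := by
  have h21 := three_half_lt_log_e21
  have h21' := log_e21_lt
  have h33 := seven_half_lt_log_e33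
  have h33' := log_e33_lt
  have hj1 : (1 : ℝ) ≤ j := by exact_mod_cast le_trans (by norm_num) hj
  have hC : (1 : ℝ) ≤ bakerC := by unfold bakerC; norm_num
  have hCj : 1 ≤ bakerC * (j : ℝ) ^ 4 := one_le_mul_of_one_le_of_one_le hC (one_le_pow₀ hj1)
  -- case 1: `u log ε₂₁ ≥ (log ε₃₃ + 1) v`
  by_cases hbig : (Real.log e33 + 1) * v ≤ u * Real.log e21
  · have : (1 : ℝ) ≤ u * Real.log e21 - v * Real.log e33 := by
      have : (1 : ℝ) ≤ v := by exact_mod_cast hv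
      nlinarith
    calc Real.exp (-(bakerC * (j : ℝ) ^ 4)) ≤ 1 := by rw [Real.exp_le_one_iff]; linarith
      _ ≤ _ := by rw [abs_of_pos (by linarith)]; exact this
  push Not at hbig
  -- reduce to coprime coefficients
  set g := Nat.gcd u v with hg
  have hg0 : 0 < g := Nat.gcd_pos_of_pos_left _ (by omega)
  obtain ⟨u', hu'⟩ : g ∣ u := Nat.gcd_dvd_left u v
  obtain ⟨v', hv'⟩ : g ∣ v := Nat.gcd_dvd_right u v
  have hcop : Nat.Coprime u' v' := by
    have := Nat.coprime_div_gcd_div_gcd hg0 (m := u) (n := v)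
    rw [← hg] at this
    have e1 : u / g = u' := by rw [hu', Nat.mul_div_cancel_left _ hg0]
    have e2 : v / g = v' := by rw [hv', Nat.mul_div_cancel_left _ hg0]
    rwa [e1, e2] at this
  have hu'1 : 1 ≤ u' := Nat.pos_of_ne_zero fun h0 => by rw [h0, mul_zero] at hu'; omega
  have hv'1 : 1 ≤ v' := Nat.pos_of_ne_zero fun h0 => by rw [h0, mul_zero] at hv'; omega
  have hgr : (1 : ℝ) ≤ g := by exact_mod_cast hg0
  have hu'le : (u' : ℝ) ≤ u := by
    have : (u : ℝ) = g * u' := by exact_mod_cast hu'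
    rw [this]; nlinarith [Nat.cast_nonneg (α := ℝ) u']
  have hv'le : (v' : ℝ) ≤ v := by
    have : (v : ℝ) = g * v' := by exact_mod_cast hv'
    rw [this]; nlinarith [Nat.cast_nonneg (α := ℝ) v']
  -- `|Λ| = g |Λ'| ≥ |Λ'|`
  have hΛ : |(u : ℝ) * Real.log e21 - v * Real.log e33| =
      g * |(u' : ℝ) * Real.log e21 - v' * Real.log e33| := by
    rw [show (u : ℝ) = g * u' by exact_mod_cast hu', show (v : ℝ) = g * v' by exact_mod_cast hv',
      ← abs_of_pos (by linarith : (0 : ℝ) < g), ← abs_mul, abs_of_pos (by linarith : (0 : ℝ) < g)]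
    ring_nf
  have hred : |(u' : ℝ) * Real.log e21 - v' * Real.log e33| ≤
      |(u : ℝ) * Real.log e21 - v * Real.log e33| := by
    rw [hΛ]; exact le_mul_of_one_le_left (abs_nonneg _) hgr
  refine le_trans ?_ hred
  -- the ratio condition for the reduced coefficients
  have hρ : (u' : ℝ) * ‖(Real.log e21 : ℂ)‖ ≤ (Real.log e33 + 1) * v' := by
    have hn : ‖(Real.log e21 : ℂ)‖ = Real.log e21 := by
      rw [Complex.norm_real, Real.norm_eq_abs, abs_of_pos (by linarith)]
    rw [hn]
    have h1 : (g : ℝ) * (u' * Real.log e21) ≤ g * ((Real.log e33 + 1) * v') := by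
      have e1 : (u : ℝ) = g * u' := by exact_mod_cast hu'
      have e2 : (v : ℝ) = g * v' := by exact_mod_cast hv'
      nlinarith
    exact le_of_mul_le_mul_left h1 (by linarith)
  -- the parameter `R = 256 · 4 · 88 · j`
  by_cases hR : pR 4 88 j ≤ u' ∨ pR 4 88 j ≤ v'
  · -- the two-logarithm bound
    have hx : Set.InjOn (fun p : ℕ × ℕ => xc u' v' p.1 p.2) ↑(grid (pR 4 88 j) (pR 4 88 j)) := by
      rcases hR with h | h
      · exact injOn_xc_of_coprime_left hcop h
      · exact injOn_xc_of_coprime_right hcop h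
    have hmain := lower_bound_explicit (algebraMap fld ℂ) a21 a33 (A := 47) (by norm_num)
      norm_conj_a21_le norm_conj_a33_le cexp_log_e21 cexp_log_e33 (b₁ := u') (b₂ := v') (by omega)
      4 finrank_fld_le 88 (ρ := Real.log e33 + 1) (by linarith) W_admissible hρ j
      (by
        have : Real.log (1024 * (4 : ℕ) * (88 : ℕ)) ≤ 13 := by
          rw [Real.log_le_iff_le_exp (by norm_num)]
          have e13 : Real.exp 13 = Real.exp 1 ^ 13 := by rw [← Real.exp_nat_mul]; norm_num
          rw [e13]
          have := pow_le_pow_left₀ (by norm_num : (0:ℝ) ≤ 2.7) exp_one_bounds.1.le 13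
          push_cast; nlinarith
        have hj15 : (15 : ℝ) ≤ j := by exact_mod_cast hj
        linarith)
      (hu'le.trans huj) (hv'le.trans hvj) hx (injOn_cexp _)
    have hnorm : ‖(u' : ℂ) * (Real.log e21 : ℂ) - v' * (Real.log e33 : ℂ)‖ =
        |(u' : ℝ) * Real.log e21 - v' * Real.log e33| := by
      rw [show (u' : ℂ) * (Real.log e21 : ℂ) - v' * (Real.log e33 : ℂ) =
          (((u' : ℝ) * Real.log e21 - v' * Real.log e33 : ℝ) : ℂ) by push_cast; ring,
        Complex.norm_real, Real.norm_eq_abs]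
    rw [hnorm] at hmain
    refine le_trans (le_of_eq ?_) hmain
    unfold bakerC; push_cast; ring_nf
  · -- Liouville for small coefficients
    push Not at hR
    obtain ⟨hRu, hRv⟩ := hR
    have hsmall := abs_linearForm_ge_of_le hu'1 hRu.le hRv.le
    refine le_trans ?_ hsmall
    rw [Real.exp_le_exp, neg_le_neg_iff]
    have hT : ((pR 4 88 j : ℕ) : ℝ) = 90112 * j := by unfold pR; push_cast; ring
    rw [hT]
    have hj4 : (j : ℝ) ≤ (j : ℝ) ^ 4 := by
      calc (j : ℝ) = j ^ 1 := (pow_one _).symm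
        _ ≤ j ^ 4 := pow_le_pow_right₀ hj1 (by norm_num)
    unfold bakerC
    nlinarith

/-! ### The large range -/

/-- `log 70128 < 12`, `log (2·10⁷) ≤ 17`, `92 ≤ log 10⁴⁰`. [folklore] -/
theorem numerics_large :
    Real.log 70128 < 12 ∧ Real.log (2 * 10 ^ 7) ≤ 17 ∧ 92 ≤ Real.log ((10 : ℝ) ^ 40) := by
  have he := exp_one_bounds
  refine ⟨?_, ?_, ?_⟩
  · rw [Real.log_lt_iff_lt_exp (by norm_num)]
    have : Real.exp 12 = Real.exp 1 ^ 12 := by rw [← Real.exp_nat_mul]; norm_num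
    rw [this]
    have := pow_le_pow_left₀ (by norm_num : (0:ℝ) ≤ 2.7) he.1.le 12
    nlinarith
  · rw [Real.log_le_iff_le_exp (by norm_num)]
    have : Real.exp 17 = Real.exp 1 ^ 17 := by rw [← Real.exp_nat_mul]; norm_num
    rw [this]
    have := pow_le_pow_left₀ (by norm_num : (0:ℝ) ≤ 2.7) he.1.le 17
    nlinarith
  · rw [Real.le_log_iff_exp_le (by norm_num)]
    have : Real.exp 92 = Real.exp 1 ^ 92 := by rw [← Real.exp_nat_mul]; norm_num
    rw [this]
    have := pow_le_pow_left₀ (by positivity) he.2.le 92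
    refine le_trans this ?_
    norm_num

/-- The key analytic inequality: `C (4x + 19)⁴ + 12 ≤ (3/33) eˣ` for `x ≥ 92`. [folklore] -/
theorem key_ineq {x : ℝ} (hx : 92 ≤ x) : bakerC * (4 * x + 19) ^ 4 + 12 ≤ 3 / 33 * Real.exp x := by
  have he := exp_one_bounds
  set s := x - 92 with hs
  have hs0 : 0 ≤ s := by linarith
  -- `e^x = e^92 e^s ≥ e^92 (1 + s/4)^4`
  have h1 : (1 + s / 4) ^ 4 ≤ Real.exp s := by
    have := Real.add_one_le_exp (s / 4)
    calc (1 + s / 4) ^ 4 ≤ Real.exp (s / 4) ^ 4 :=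
          pow_le_pow_left₀ (by linarith) (by linarith) 4
      _ = Real.exp s := by rw [← Real.exp_nat_mul]; ring_nf
  have h2 : Real.exp x = Real.exp 92 * Real.exp s := by rw [← Real.exp_add]; congr 1; linarith
  -- `(4x+19)^4 = 387^4 (1 + 4s/387)^4 ≤ 387^4 (1 + s/4)^4`
  have h3 : (4 * x + 19) ^ 4 ≤ 387 ^ 4 * (1 + s / 4) ^ 4 := by
    have e : 4 * x + 19 = 387 * (1 + 4 * s / 387) := by rw [hs]; ring
    rw [e, mul_pow]
    apply mul_le_mul_of_nonneg_left _ (by norm_num)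
    apply pow_le_pow_left₀ (by positivity)
    linarith
  -- numerics at `x = 92`
  have h92 : bakerC * 387 ^ 4 + 12 ≤ 3 / 33 * Real.exp 92 := by
    have : Real.exp 92 = Real.exp 1 ^ 92 := by rw [← Real.exp_nat_mul]; norm_num
    rw [this]
    have := pow_le_pow_left₀ (by norm_num : (0:ℝ) ≤ 2.7) he.1.le 92
    unfold bakerC
    nlinarith
  have h4 : (1 : ℝ) ≤ (1 + s / 4) ^ 4 := one_le_pow₀ (by linarith)
  calc bakerC * (4 * x + 19) ^ 4 + 12
      ≤ bakerC * (387 ^ 4 * (1 + s / 4) ^ 4) + 12 * (1 + s / 4) ^ 4 := by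
        have hC : (0 : ℝ) ≤ bakerC := by unfold bakerC; positivity
        nlinarith [mul_le_mul_of_nonneg_left h3 hC]
    _ = (bakerC * 387 ^ 4 + 12) * (1 + s / 4) ^ 4 := by ring
    _ ≤ (3 / 33 * Real.exp 92) * (1 + s / 4) ^ 4 := mul_le_mul_of_nonneg_right h92 (by positivity)
    _ ≤ (3 / 33 * Real.exp 92) * Real.exp s := mul_le_mul_of_nonneg_left h1 (by positivity)
    _ = 3 / 33 * Real.exp x := by rw [h2]; ring

/-- **The large range of Baker's argument**: for `p₀ > 10⁸⁰` the fundamental inequality fails,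
i.e. `35280 e^{-π√p₀/21} + 34848 e^{-π√p₀/33} < |105 h₂₁ X₂₁ - 66 h₃₃ X₃₃|` for all
`h₂₁ ∈ [1, 2(21p₀)²]`, `h₃₃ ∈ [1, 2(33p₀)²]` — the `large` hypothesis of
`heegnerStarkPrimeThreeModEight_of_ranges` with `P₀ = 10⁸⁰`.
[cite: Baker1975, Ch. 5 §4 (p. 51: "|Λ| > B^{-C} … and so d is bounded")] -/
theorem baker_large_range (p₀ : ℕ) (_hp : p₀.Prime) (_h8 : p₀ % 8 = 3) (hP : 10 ^ 80 < p₀)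
    (h₂₁ h₃₃ : ℕ) (ha : 1 ≤ h₂₁) (hb : (h₂₁ : ℝ) ≤ 2 * (21 * (p₀ : ℝ)) ^ 2) (hc : 1 ≤ h₃₃)
    (hd : (h₃₃ : ℝ) ≤ 2 * (33 * (p₀ : ℝ)) ^ 2) :
    35280 * Real.exp (-(Real.pi * Real.sqrt p₀ / 21)) + 34848 * Real.exp (-(Real.pi * Real.sqrt p₀ / 33)) <
      ‖(105 * h₂₁ : ℂ) * bakerX 21 - (66 * h₃₃ : ℂ) * bakerX 33‖ := by
  obtain ⟨g₂₁, hg1, hg64, hX21⟩ := bakerX_21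
  obtain ⟨g₃₃, hg1', hg54, hX33⟩ := bakerX_33
  -- the linear form with natural coefficients `u = 210 h₂₁ h(21)`, `v = 132 h₃₃ h(33)`
  set u : ℕ := 210 * h₂₁ * g₂₁ with hu
  set v : ℕ := 132 * h₃₃ * g₃₃ with hv
  have hnorm : ‖(105 * h₂₁ : ℂ) * bakerX 21 - (66 * h₃₃ : ℂ) * bakerX 33‖ =
      |(u : ℝ) * Real.log e21 - v * Real.log e33| := by
    rw [hX21, hX33, show (105 * h₂₁ : ℂ) * ((2 * g₂₁ * Real.log e21 : ℝ) : ℂ) -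
        (66 * h₃₃ : ℂ) * ((2 * g₃₃ * Real.log e33 : ℝ) : ℂ) =
        (((u : ℝ) * Real.log e21 - v * Real.log e33 : ℝ) : ℂ) by rw [hu, hv]; push_cast; ring,
      Complex.norm_real, Real.norm_eq_abs]
  rw [hnorm]
  -- sizes
  have hp0 : (10 : ℝ) ^ 80 < p₀ := by exact_mod_cast hP
  have hp1 : (1 : ℝ) ≤ p₀ := by linarith [show (1:ℝ) ≤ (10:ℝ) ^ 80 by norm_num]
  have hu1 : 1 ≤ u := by rw [hu]; exact Nat.one_le_iff_ne_zero.mpr (by positivity)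
  have hv1 : 1 ≤ v := by rw [hv]; exact Nat.one_le_iff_ne_zero.mpr (by positivity)
  set B : ℝ := 2 * 10 ^ 7 * (p₀ : ℝ) ^ 2 with hB
  have hB1 : 1 ≤ B := by
    rw [hB]
    have : (1 : ℝ) ≤ (p₀ : ℝ) ^ 2 := one_le_pow₀ hp1
    linarith
  have huB : (u : ℝ) ≤ B := by
    rw [hu, hB]; push_cast
    have : (g₂₁ : ℝ) ≤ 64 := by exact_mod_cast hg64
    have h0 : (0 : ℝ) ≤ h₂₁ := Nat.cast_nonneg _
    nlinarith
  have hvB : (v : ℝ) ≤ B := by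
    rw [hv, hB]; push_cast
    have : (g₃₃ : ℝ) ≤ 54 := by exact_mod_cast hg54
    have h0 : (0 : ℝ) ≤ h₃₃ := Nat.cast_nonneg _
    nlinarith
  -- `j = ⌈log B⌉`
  set j : ℕ := ⌈Real.log B⌉₊ with hj
  have hlogB0 : 0 ≤ Real.log B := Real.log_nonneg hB1
  have hjge : Real.log B ≤ j := Nat.le_ceil _
  have hjle : (j : ℝ) < Real.log B + 1 := Nat.ceil_lt_add_one hlogB0
  have hBexp : B ≤ Real.exp j := by
    calc B = Real.exp (Real.log B) := (Real.exp_log (by linarith)).symm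
      _ ≤ Real.exp j := Real.exp_le_exp.mpr hjge
  obtain ⟨hn70, hn17, hn92⟩ := numerics_large
  -- `x = log √p₀ ≥ 92` and `log B = log (2·10⁷) + 4x`
  have hsqrt0 : 0 < Real.sqrt p₀ := Real.sqrt_pos.mpr (by linarith)
  set x : ℝ := Real.log (Real.sqrt p₀) with hx
  have hexpx : Real.exp x = Real.sqrt p₀ := Real.exp_log hsqrt0
  have hx92 : 92 ≤ x := by
    have h1 : (10 : ℝ) ^ 40 ≤ Real.sqrt p₀ := by
      rw [show (10 : ℝ) ^ 40 = Real.sqrt ((10 : ℝ) ^ 80) by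
        rw [show ((10 : ℝ) ^ 80) = ((10 : ℝ) ^ 40) ^ 2 by norm_num, Real.sqrt_sq (by positivity)]]
      exact Real.sqrt_le_sqrt hp0.le
    calc (92 : ℝ) ≤ Real.log ((10 : ℝ) ^ 40) := hn92
      _ ≤ x := Real.log_le_log (by positivity) h1
  have hlogB : Real.log B = Real.log (2 * 10 ^ 7) + 4 * x := by
    rw [hB, Real.log_mul (by norm_num) (by positivity), Real.log_pow, hx, Real.log_sqrt (by linarith)]
    ring
  have hjx : (j : ℝ) ≤ 4 * x + 19 := by linarith
  have hj15 : 15 ≤ j := by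
    have : (15 : ℝ) ≤ j := by
      have : Real.log (2 * 10 ^ 7) ≥ 0 := Real.log_nonneg (by norm_num)
      linarith
    exact_mod_cast this
  -- the lower bound for the linear form
  have hlow := abs_linearForm_ge hu1 hv1 hj15 (huB.trans hBexp) (hvB.trans hBexp)
  refine lt_of_lt_of_le ?_ hlow
  -- the upper bound for the left-hand side
  have hπ : 3 < Real.pi := Real.pi_gt_three
  have hmono : Real.exp (-(Real.pi * Real.sqrt p₀ / 21)) ≤ Real.exp (-(Real.pi * Real.sqrt p₀ / 33)) := by
    rw [Real.exp_le_exp]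
    have : 0 ≤ Real.pi * Real.sqrt p₀ := by positivity
    have : Real.pi * Real.sqrt p₀ / 33 ≤ Real.pi * Real.sqrt p₀ / 21 :=
      div_le_div_of_nonneg_left this (by norm_num) (by norm_num)
    linarith
  have hkey := key_ineq hx92
  have hj0 : (0 : ℝ) ≤ j := Nat.cast_nonneg _
  have hjpow : bakerC * (j : ℝ) ^ 4 ≤ bakerC * (4 * x + 19) ^ 4 := by
    apply mul_le_mul_of_nonneg_left _ (by unfold bakerC; positivity)
    exact pow_le_pow_left₀ hj0 hjx 4
  calc 35280 * Real.exp (-(Real.pi * Real.sqrt p₀ / 21)) + 34848 * Real.exp (-(Real.pi * Real.sqrt p₀ / 33))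
      ≤ 70128 * Real.exp (-(Real.pi * Real.sqrt p₀ / 33)) := by linarith
    _ = Real.exp (Real.log 70128 - Real.pi * Real.sqrt p₀ / 33) := by
        rw [Real.exp_sub, Real.exp_log (by norm_num), Real.exp_neg]
        exact (div_eq_mul_inv _ _).symm
    _ < Real.exp (-(bakerC * (j : ℝ) ^ 4)) := by
        rw [Real.exp_lt_exp, ← hexpx]
        have : 3 / 33 * Real.exp x ≤ Real.pi * Real.exp x / 33 := by
          rw [div_mul_eq_mul_div]
          apply div_le_div_of_nonneg_right _ (by norm_num)
          exact mul_le_mul_of_nonneg_right hπ.le (Real.exp_pos x).le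
        linarith

/-- **`HeegnerStarkPrimeThreeModEight` from the small range alone.** With the large range settled
(`baker_large_range`), Heegner–Stark for primes `p ≡ 3 (mod 8)` follows from the finite statement
that no prime `p₀ ≡ 3 (mod 8)` with `163 < p₀ ≤ 10⁸⁰` has `h(-p₀) = 1`. [cite: Baker1975, Ch. 5 §§4–5] -/
theorem heegnerStarkPrimeThreeModEight_of_small
    (small : ∀ p₀ : ℕ, p₀.Prime → p₀ % 8 = 3 → p₀ ≤ 10 ^ 80 →
      BinaryQuadraticForm.classNumber (-(p₀ : ℤ)) = 1 → p₀ ∈ ({3, 11, 19, 43, 67, 163} : Finset ℕ)) :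
    BinaryQuadraticForm.HeegnerStarkPrimeThreeModEight :=
  heegnerStarkPrimeThreeModEight_of_ranges (10 ^ 80) (by norm_num) small baker_large_range

end Literature.NumberTheory.QuadraticFields.BakerLimitFormula

end
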